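import Mathlib
import Summits.NavierStokesRegularity.NavierStokesRegularity.Theorems.QuasipotentialCoercivityTwoDimensionalActionBoundCancel
import Summits.NavierStokesRegularity.NavierStokesRegularity.Theorems.QuasipotentialCoercivityTwoDimensionalActionBoundBalance
import Summits.NavierStokesRegularity.NavierStokesRegularity.Theses.QuasipotentialCoercivity
import Literature.MathematicalPhysics.KineticTheory.DiPernaLionsExpDuhamel
import HarnessLib

/-!
# `QuasipotentialCoercivity.TwoDimensionalActionBound` — the 2-D calibration of the action
  (item stmt-NavierStokesRegularity-1446)

**Statement.** For `ν > 0`, `T₀ > 0` and a classical forced path `(w, q, g)` on `ℝ² × [0, T₀]`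
(`IsClassicalNSSolutionOn (Icc 0 T₀) ν g w q`) with `w` uniformly Schwartz
(`HasUniformRapidDecayOn`) and `w 0 = 0`:
`ν ∫ |∇w(T₀)|²_F ≤ ∫₀^{T₀} ∫ |g|²` (in `[0, ∞]`; Brzeźniak–Cerrai–Freidlin 2015, Thm. 7.1, the easy
inequality "quasipotential ≤ enstrophy-type action", here on `ℝ²` from rest).

PROOF. (1) At each time `t`, with `v = w(t)`, `V = ∂ₜw(t)`, `P = q(t)`, `f = g(t)`:
`∫ Σᵢ⟪∂ᵢv, ∂ᵢV⟫ = −∫⟪Δv, V⟫` (Green) `= −ν‖Δv‖² + ∫⟪Δv,(v·∇)v⟫ + ∫⟪Δv,∇P⟫ − ∫⟪Δv,f⟫`; the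
convection pairing vanishes in the plane (no vortex stretching: `tr((Dv)ᵀ(Dv)²) = 0` for traceless
`2×2` matrices, plus transport), and so does the pressure pairing (`⟪Δv,∇P⟫ = div(ω ∇⊥P)`-type
identity with `ω = curl2 v`, `Δv = ∇⊥ω`, integrated with the `L¹` divergence theorem — licit because
`∇P = f − V − (v·∇)v + νΔv ∈ L² + L^∞`; no growth hypothesis on `q` is needed); completing the square,
`4ν ∫ Σᵢ⟪∂ᵢv, ∂ᵢV⟫ ≤ ∫ |f|²` (`TwoDimActionBound.production_le₂`; trivial in `[0,∞]` if `f ∉ L²`).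
(2) The gradient-energy balance `∫|∇w(T₀)|²_F = ∫|∇w(0)|²_F + ∫₀^{T₀}∫ 2Σᵢ⟪∂ᵢw, ∂ᵢ∂ₜw⟫`
(`TwoDimActionBound.gradEnergy_balance`, from the uniform Schwartz bounds) with `w(0) = 0`.
(3) Hence even `2ν ∫|∇w(T₀)|²_F ≤ ∫₀^{T₀}∫|g|²`.

HONEST FRAMING: a two-dimensional unit test of the route's definitions (a known calibration);
nothing here bears on three-dimensional Navier–Stokes regularity.

## References
* Z. Brzeźniak, S. Cerrai, M. Freidlin, *Quasipotential and exit time for 2D stochastic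
  Navier–Stokes equations driven by space time white noise*, PTRF 162 (2015), Thm. 7.1.
  [BrzezniakCerraiFreidlin2015]
* A. J. Majda, A. L. Bertozzi, *Vorticity and Incompressible Flow*, CUP (2002), §1.7–§1.8.
  [MajdaBertozzi2002]
-/

noncomputable section

set_option linter.dupNamespace false

namespace Summit.NavierStokesRegularity.NavierStokesRegularity.Theorems

open Set MeasureTheory Filter Topology Function InnerProductSpace
open scoped ENNReal NNReal RealInnerProductSpace ContDiff Laplacian
open Literature.Analysis.FluidPDE

namespace TwoDimActionBound

/-! ### The gradient-energy production at a fixed time -/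

/-- **The production bound at a fixed time.** Let `v ∈ C²((EuclideanSpace ℝ (Fin 2)); (EuclideanSpace ℝ (Fin 2)))` be divergence free and decay
with its first two derivatives like `(1 + ‖x‖)^{-r}`, `r > 3`; let `V ∈ C¹` decay with its
derivative likewise, `P ∈ C²`, and suppose the forced Navier–Stokes momentum relation
`V + (v·∇)v = νΔv − ∇P + f` holds pointwise (`V` playing `∂ₜv`). If `f ∈ L²` then
`4ν ∫ Σᵢ ⟪∂ᵢv, ∂ᵢV⟫ ≤ ∫ ‖f‖²`.
Proof: Green `∫ Σᵢ⟪∂ᵢv, ∂ᵢV⟫ = −∫⟪Δv, V⟫`; insert the equation; the convection pairing vanishes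
(2-D cancellation `integral_inner_laplacian_convect_self_eq_zero₂`) and so does the pressure
pairing (`integral_inner_laplacian_gradient_eq_zero₂`, licit since `∇P = f − V − (v·∇)v + νΔv ∈
L² + L^∞`); what is left is `∫ (−ν‖Δv‖² − ⟪Δv, f⟫) ≤ ∫ ‖f‖²/(4ν)`. [folklore] -/
theorem production_le₂ {ν : ℝ} (hν : 0 < ν) {v V f : (EuclideanSpace ℝ (Fin 2)) → (EuclideanSpace ℝ (Fin 2))} {P : (EuclideanSpace ℝ (Fin 2)) → ℝ}
    (hv : ContDiff ℝ 2 v) (hV : ContDiff ℝ 1 V) (hP : ContDiff ℝ 2 P)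
    (hdiv : VectorCalculus.IsDivFree v)
    (heq : ∀ x, V x + convect v v x = ν • (Δ v) x - gradient P x + f x)
    {C r : ℝ} (hC : 0 ≤ C) (hr : 3 < r)
    (h0 : ∀ x, ‖v x‖ ≤ C * (1 + ‖x‖) ^ (-r)) (h1 : ∀ x, ‖fderiv ℝ v x‖ ≤ C * (1 + ‖x‖) ^ (-r))
    (h2 : ∀ x, ‖fderiv ℝ (fderiv ℝ v) x‖ ≤ C * (1 + ‖x‖) ^ (-r))
    (hV0 : ∀ x, ‖V x‖ ≤ C * (1 + ‖x‖) ^ (-r)) (hV1 : ∀ x, ‖fderiv ℝ V x‖ ≤ C * (1 + ‖x‖) ^ (-r))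
    (hf : ∫⁻ x, ‖f x‖ₑ ^ 2 < ⊤) :
    4 * ν * ∫ x, ∑ i, ⟪fderiv ℝ v x (EuclideanSpace.basisFun (Fin 2) ℝ i), fderiv ℝ V x (EuclideanSpace.basisFun (Fin 2) ℝ i)⟫ ≤ ∫ x, ‖f x‖ ^ 2 := by
  have hr2 : (2 : ℝ) < r := by linarith
  have hr0 : 0 ≤ r := by linarith
  have hv1 : ContDiff ℝ 1 v := hv.of_le (by norm_num)
  have hD1 : ContDiff ℝ 1 (fderiv ℝ v) := hv.fderiv_right (m := 1) (by norm_num)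
  have hdd : ∀ x, DifferentiableAt ℝ (fderiv ℝ v) x := fun x => (hD1.differentiable one_ne_zero) x
  have cv : Continuous v := hv.continuous
  have cDv : Continuous (fderiv ℝ v) := hv.continuous_fderiv (by norm_num)
  have cV : Continuous V := hV.continuous
  have cDV : Continuous (fderiv ℝ V) := hV.continuous_fderiv one_ne_zero
  have cΔ : Continuous (Δ v) := continuous_laplacian hv
  have cc : Continuous (convect v v) := cDv.clm_apply cv
  have cgP : Continuous (gradient P) := continuous_gradient_of_contDiff (hP.of_le (by norm_num))
  have cDP : Continuous (fderiv ℝ P) := hP.continuous_fderiv (by norm_num)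
  have he1 : ∀ i, ‖(EuclideanSpace.basisFun (Fin 2) ℝ i : (EuclideanSpace ℝ (Fin 2)))‖ = 1 := fun i => (EuclideanSpace.basisFun (Fin 2) ℝ).orthonormal.1 i
  have hle1 : ∀ x : (EuclideanSpace ℝ (Fin 2)), (1 + ‖x‖) ^ (-r) ≤ (1 : ℝ) := fun x => rpow_neg_le_one x hr0
  have hwpos : ∀ x : (EuclideanSpace ℝ (Fin 2)), 0 ≤ C * (1 + ‖x‖) ^ (-r) := fun x => (norm_nonneg _).trans (h0 x)
  -- `f` is continuous and square integrable
  have hfeq : ∀ x, f x = V x + convect v v x - ν • (Δ v) x + gradient P x := fun x => by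
    rw [heq x]; abel
  have cf : Continuous f := by
    have hc : Continuous fun x => V x + convect v v x - ν • (Δ v) x + gradient P x :=
      ((cV.add cc).sub (cΔ.const_smul ν)).add cgP
    exact hc.congr fun x => (hfeq x).symm
  have hf2 : Integrable (fun x => ‖f x‖ ^ 2) volume := integrable_sq_of_lintegral_lt_top₂ cf hf
  -- pointwise bounds
  have bΔ : ∀ x, ‖(Δ v) x‖ ≤ 2 * C * (1 + ‖x‖) ^ (-r) := fun x => by
    calc ‖(Δ v) x‖ ≤ Module.finrank ℝ (EuclideanSpace ℝ (Fin 2)) * ‖fderiv ℝ (fderiv ℝ v) x‖ := norm_laplacian_le v x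
      _ = 2 * ‖fderiv ℝ (fderiv ℝ v) x‖ := by simp
      _ ≤ 2 * (C * (1 + ‖x‖) ^ (-r)) := by gcongr; exact h2 x
      _ = 2 * C * (1 + ‖x‖) ^ (-r) := by ring
  have bvs : ∀ i x, ‖fderiv ℝ v x (EuclideanSpace.basisFun (Fin 2) ℝ i)‖ ≤ C * (1 + ‖x‖) ^ (-r) := fun i x =>
    (((fderiv ℝ v x).le_opNorm _).trans (by rw [he1, mul_one])).trans (h1 x)
  have bVs : ∀ i x, ‖fderiv ℝ V x (EuclideanSpace.basisFun (Fin 2) ℝ i)‖ ≤ C * (1 + ‖x‖) ^ (-r) := fun i x =>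
    (((fderiv ℝ V x).le_opNorm _).trans (by rw [he1, mul_one])).trans (hV1 x)
  have bvss : ∀ i x, ‖fderiv ℝ (fun y => fderiv ℝ v y (EuclideanSpace.basisFun (Fin 2) ℝ i)) x (EuclideanSpace.basisFun (Fin 2) ℝ i)‖ ≤ C * (1 + ‖x‖) ^ (-r) :=
    fun i x => by
    rw [fderiv_apply_const_apply₂ (hdd x)]
    calc ‖fderiv ℝ (fderiv ℝ v) x (EuclideanSpace.basisFun (Fin 2) ℝ i) (EuclideanSpace.basisFun (Fin 2) ℝ i)‖
        ≤ ‖fderiv ℝ (fderiv ℝ v) x (EuclideanSpace.basisFun (Fin 2) ℝ i)‖ * ‖(EuclideanSpace.basisFun (Fin 2) ℝ i : (EuclideanSpace ℝ (Fin 2)))‖ := (fderiv ℝ (fderiv ℝ v) x (EuclideanSpace.basisFun (Fin 2) ℝ i)).le_opNorm _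
      _ ≤ (‖fderiv ℝ (fderiv ℝ v) x‖ * ‖(EuclideanSpace.basisFun (Fin 2) ℝ i : (EuclideanSpace ℝ (Fin 2)))‖) * ‖(EuclideanSpace.basisFun (Fin 2) ℝ i : (EuclideanSpace ℝ (Fin 2)))‖ := by
          gcongr; exact (fderiv ℝ (fderiv ℝ v) x).le_opNorm _
      _ = ‖fderiv ℝ (fderiv ℝ v) x‖ := by rw [he1, mul_one, mul_one]
      _ ≤ C * (1 + ‖x‖) ^ (-r) := h2 x
  have bc : ∀ x, ‖convect v v x‖ ≤ C * C * (1 + ‖x‖) ^ (-r) := fun x => by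
    calc ‖convect v v x‖ ≤ ‖fderiv ℝ v x‖ * ‖v x‖ := (fderiv ℝ v x).le_opNorm _
      _ ≤ (C * (1 + ‖x‖) ^ (-r)) * (C * (1 + ‖x‖) ^ (-r)) :=
          mul_le_mul (h1 x) (h0 x) (norm_nonneg _) (hwpos x)
      _ ≤ (C * 1) * (C * (1 + ‖x‖) ^ (-r)) := by gcongr; exact hle1 x
      _ = C * C * (1 + ‖x‖) ^ (-r) := by ring
  have prod_le : ∀ {a b A B : ℝ} (x : (EuclideanSpace ℝ (Fin 2))), 0 ≤ a → 0 ≤ b → a ≤ A * (1 + ‖x‖) ^ (-r) →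
      b ≤ B * (1 + ‖x‖) ^ (-r) → 0 ≤ A → a * b ≤ A * B * (1 + ‖x‖) ^ (-r) :=
    fun x ha hb haA hbB hA => mul_le_decay₂ hr0 x ha hb haA hbB hA
  have hC2 : 0 ≤ 2 * C := by positivity
  -- Green: `∫ Σᵢ ⟪∂ᵢv, ∂ᵢV⟫ = -∫ ⟪Δv, V⟫`
  have I1 : ∀ i, Integrable (fun x => ⟪fderiv ℝ (fun y => fderiv ℝ v y (EuclideanSpace.basisFun (Fin 2) ℝ i)) x (EuclideanSpace.basisFun (Fin 2) ℝ i), V x⟫)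
      volume := fun i =>
    integrable_of_le_decay₂ ((((hv.fderiv_right (m := 1) (by norm_num)).clm_apply
      contDiff_const).continuous_fderiv one_ne_zero).clm_apply continuous_const |>.inner cV) hr2
      fun x => (norm_inner_le_norm _ _).trans
        (prod_le x (norm_nonneg _) (norm_nonneg _) (bvss i x) (hV0 x) hC)
  have I2 : ∀ i, Integrable (fun x => ⟪fderiv ℝ v x (EuclideanSpace.basisFun (Fin 2) ℝ i), fderiv ℝ V x (EuclideanSpace.basisFun (Fin 2) ℝ i)⟫) volume :=
    fun i => integrable_of_le_decay₂ ((cDv.clm_apply continuous_const).inner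
      (cDV.clm_apply continuous_const)) hr2 fun x => (norm_inner_le_norm _ _).trans
        (prod_le x (norm_nonneg _) (norm_nonneg _) (bvs i x) (bVs i x) hC)
  have I3 : ∀ i, Integrable (fun x => ⟪fderiv ℝ v x (EuclideanSpace.basisFun (Fin 2) ℝ i), V x⟫) volume :=
    fun i => integrable_of_le_decay₂ ((cDv.clm_apply continuous_const).inner cV) hr2
      fun x => (norm_inner_le_norm _ _).trans
        (prod_le x (norm_nonneg _) (norm_nonneg _) (bvs i x) (hV0 x) hC)
  have hG := green_sum_inner_fderiv₂ hv hV I1 I2 I3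
  -- integrability of the four pairings of `Δv`
  have iΔV : Integrable (fun x => ⟪(Δ v) x, V x⟫) volume :=
    integrable_of_le_decay₂ (cΔ.inner cV) hr2 fun x => (norm_inner_le_norm _ _).trans
      (prod_le x (norm_nonneg _) (norm_nonneg _) (bΔ x) (hV0 x) hC2)
  have iΔΔ : Integrable (fun x => ‖(Δ v) x‖ ^ 2) volume :=
    integrable_of_le_decay₂ ((cΔ.norm).pow 2) hr2 fun x => by
      rw [norm_pow, norm_norm, sq]
      exact prod_le x (norm_nonneg _) (norm_nonneg _) (bΔ x) (bΔ x) hC2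
  have iΔc : Integrable (fun x => ⟪(Δ v) x, convect v v x⟫) volume :=
    integrable_of_le_decay₂ (cΔ.inner cc) hr2 fun x => (norm_inner_le_norm _ _).trans
      (prod_le x (norm_nonneg _) (norm_nonneg _) (bΔ x) (bc x) hC2)
  have iΔf : Integrable (fun x => ⟪(Δ v) x, f x⟫) volume := by
    have hb : Integrable (fun x => (‖(Δ v) x‖ ^ 2 + ‖f x‖ ^ 2) / 2) volume := by
      exact (iΔΔ.add hf2).div_const 2
    refine hb.mono' (cΔ.inner cf).aestronglyMeasurable (Eventually.of_forall fun x => ?_)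
    have h1' : ‖⟪(Δ v) x, f x⟫‖ ≤ ‖(Δ v) x‖ * ‖f x‖ := norm_inner_le_norm _ _
    have h2' : ‖(Δ v) x‖ * ‖f x‖ ≤ (‖(Δ v) x‖ ^ 2 + ‖f x‖ ^ 2) / 2 := by
      nlinarith [sq_nonneg (‖(Δ v) x‖ - ‖f x‖)]
    exact h1'.trans h2'
  have hPeq : ∀ x, gradient P x = ν • (Δ v) x - convect v v x + f x - V x := fun x => by
    rw [hfeq x]; abel
  have iΔP : Integrable (fun x => ⟪(Δ v) x, gradient P x⟫) volume := by
    have : (fun x => ⟪(Δ v) x, gradient P x⟫) =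
        fun x => ν * ‖(Δ v) x‖ ^ 2 - ⟪(Δ v) x, convect v v x⟫ + ⟪(Δ v) x, f x⟫ - ⟪(Δ v) x, V x⟫ := by
      funext x
      rw [hPeq x, inner_sub_right, inner_add_right, inner_sub_right, real_inner_smul_right,
        real_inner_self_eq_norm_sq]
    rw [this]
    exact (((iΔΔ.const_mul ν).sub iΔc).add iΔf).sub iΔV
  -- the two vanishing pairings
  have hB3 : ∫ x, ⟪(Δ v) x, convect v v x⟫ = 0 :=
    integral_inner_laplacian_convect_self_eq_zero₂ hv hdiv hC hr h0 h1 h2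
  have hZ : Integrable (fun x => ‖fderiv ℝ v x‖ * ‖fderiv ℝ P x‖) volume := by
    refine integrable_norm_mul_norm_of_bounds₂ cDv cDP hf2 hC (K := ν * (2 * C) + C * C + C)
      (by positivity) hr2 hr0 h1 fun x => ?_
    rw [← norm_gradient_eq₂, hPeq x]
    have ha : ‖ν • (Δ v) x‖ ≤ ν * (2 * C * (1 + ‖x‖) ^ (-r)) := by
      rw [norm_smul, Real.norm_eq_abs, abs_of_pos hν]
      exact mul_le_mul_of_nonneg_left (bΔ x) hν.le
    have hb := bc x
    have hd := hV0 x
    have t1 : ‖ν • (Δ v) x - convect v v x + f x - V x‖ ≤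
        ‖ν • (Δ v) x - convect v v x + f x‖ + ‖V x‖ := norm_sub_le _ _
    have t2 : ‖ν • (Δ v) x - convect v v x + f x‖ ≤ ‖ν • (Δ v) x - convect v v x‖ + ‖f x‖ :=
      norm_add_le _ _
    have t3 : ‖ν • (Δ v) x - convect v v x‖ ≤ ‖ν • (Δ v) x‖ + ‖convect v v x‖ := norm_sub_le _ _
    have expand : (ν * (2 * C) + C * C + C) * (1 + ‖x‖) ^ (-r) =
        ν * (2 * C * (1 + ‖x‖) ^ (-r)) + C * C * (1 + ‖x‖) ^ (-r) + C * (1 + ‖x‖) ^ (-r) := by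
      ring
    rw [expand]
    linarith
  have hB4 : ∫ x, ⟪(Δ v) x, gradient P x⟫ = 0 :=
    integral_inner_laplacian_gradient_eq_zero₂ hv hdiv hP hZ iΔP
  -- evaluate `∫ ⟪Δv, V⟫`
  have hΔV : ∫ x, ⟪(Δ v) x, V x⟫ = ν * (∫ x, ‖(Δ v) x‖ ^ 2) + ∫ x, ⟪(Δ v) x, f x⟫ := by
    have hpt : (fun x => ⟪(Δ v) x, V x⟫) =
        fun x => (ν * ‖(Δ v) x‖ ^ 2 - ⟪(Δ v) x, convect v v x⟫) -
          ⟪(Δ v) x, gradient P x⟫ + ⟪(Δ v) x, f x⟫ := by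
      funext x
      have hVx : V x = ν • (Δ v) x - convect v v x - gradient P x + f x := by
        rw [eq_sub_of_add_eq (heq x)]; abel
      rw [hVx, inner_add_right, inner_sub_right, inner_sub_right, real_inner_smul_right,
        real_inner_self_eq_norm_sq]
    have iA : Integrable (fun x => ν * ‖(Δ v) x‖ ^ 2) volume := iΔΔ.const_mul ν
    have iB : Integrable (fun x => ν * ‖(Δ v) x‖ ^ 2 - ⟪(Δ v) x, convect v v x⟫) volume :=
      iA.sub iΔc
    have iC : Integrable (fun x => (ν * ‖(Δ v) x‖ ^ 2 - ⟪(Δ v) x, convect v v x⟫) -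
        ⟪(Δ v) x, gradient P x⟫) volume := iB.sub iΔP
    rw [hpt, integral_add iC iΔf, integral_sub iB iΔP, integral_sub iA iΔc, integral_const_mul,
      hB3, hB4]
    ring
  -- conclude
  have iN : Integrable (fun x => -(ν * ‖(Δ v) x‖ ^ 2)) volume := (iΔΔ.const_mul ν).neg
  have hprod : ∫ x, ∑ i, ⟪fderiv ℝ v x (EuclideanSpace.basisFun (Fin 2) ℝ i), fderiv ℝ V x (EuclideanSpace.basisFun (Fin 2) ℝ i)⟫ =
      ∫ x, (-(ν * ‖(Δ v) x‖ ^ 2) - ⟪(Δ v) x, f x⟫) := by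
    rw [hG, hΔV, integral_sub iN iΔf, integral_neg, integral_const_mul]
    ring
  have iM : Integrable (fun x => 4 * ν * (-(ν * ‖(Δ v) x‖ ^ 2) - ⟪(Δ v) x, f x⟫)) volume :=
    (iN.sub iΔf).const_mul _
  rw [hprod, ← integral_const_mul]
  exact integral_mono iM hf2 fun x => four_mul_production_le ν _ _

/-! ### Assembly: the 2-D calibration inequality -/

/-- The force of a classical path is continuous: `f = V + (v·∇)v − νΔv + ∇P`. [folklore] -/
theorem continuous_force₂ {ν : ℝ} {v V f : (EuclideanSpace ℝ (Fin 2)) → (EuclideanSpace ℝ (Fin 2))} {P : (EuclideanSpace ℝ (Fin 2)) → ℝ}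
    (hv : ContDiff ℝ 2 v) (hV : ContDiff ℝ 1 V) (hP : ContDiff ℝ 2 P)
    (heq : ∀ x, V x + convect v v x = ν • (Δ v) x - gradient P x + f x) : Continuous f := by
  have cDv : Continuous (fderiv ℝ v) := hv.continuous_fderiv (by norm_num)
  have hc : Continuous fun x => V x + convect v v x - ν • (Δ v) x + gradient P x :=
    ((hV.continuous.add (cDv.clm_apply hv.continuous)).sub ((continuous_laplacian hv).const_smul ν)).add
      (continuous_gradient_of_contDiff (hP.of_le (by norm_num)))
  refine hc.congr fun x => ?_
  rw [heq x]; abel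

/-- **The production bound in `[0, ∞]` form**: under the hypotheses of `production_le₂` except
square-integrability of `f`, `ofReal (4ν ∫ Σᵢ ⟪∂ᵢv, ∂ᵢV⟫) ≤ ∫⁻ ‖f‖ₑ²` (trivial when the right side
is infinite). [folklore] -/
theorem ofReal_production_le₂ {ν : ℝ} (hν : 0 < ν) {v V f : (EuclideanSpace ℝ (Fin 2)) → (EuclideanSpace ℝ (Fin 2))} {P : (EuclideanSpace ℝ (Fin 2)) → ℝ}
    (hv : ContDiff ℝ 2 v) (hV : ContDiff ℝ 1 V) (hP : ContDiff ℝ 2 P)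
    (hdiv : VectorCalculus.IsDivFree v)
    (heq : ∀ x, V x + convect v v x = ν • (Δ v) x - gradient P x + f x)
    {C r : ℝ} (hC : 0 ≤ C) (hr : 3 < r)
    (h0 : ∀ x, ‖v x‖ ≤ C * (1 + ‖x‖) ^ (-r)) (h1 : ∀ x, ‖fderiv ℝ v x‖ ≤ C * (1 + ‖x‖) ^ (-r))
    (h2 : ∀ x, ‖fderiv ℝ (fderiv ℝ v) x‖ ≤ C * (1 + ‖x‖) ^ (-r))
    (hV0 : ∀ x, ‖V x‖ ≤ C * (1 + ‖x‖) ^ (-r)) (hV1 : ∀ x, ‖fderiv ℝ V x‖ ≤ C * (1 + ‖x‖) ^ (-r)) :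
    ENNReal.ofReal (4 * ν * ∫ x, ∑ i, ⟪fderiv ℝ v x (EuclideanSpace.basisFun (Fin 2) ℝ i), fderiv ℝ V x (EuclideanSpace.basisFun (Fin 2) ℝ i)⟫) ≤
      ∫⁻ x, ‖f x‖ₑ ^ 2 := by
  by_cases hf : ∫⁻ x, ‖f x‖ₑ ^ 2 < ⊤
  · have cf := continuous_force₂ hv hV hP heq
    have hf2 := integrable_sq_of_lintegral_lt_top₂ cf hf
    have h := production_le₂ hν hv hV hP hdiv heq hC hr h0 h1 h2 hV0 hV1 hf
    calc ENNReal.ofReal (4 * ν * ∫ x, ∑ i, ⟪fderiv ℝ v x (EuclideanSpace.basisFun (Fin 2) ℝ i), fderiv ℝ V x (EuclideanSpace.basisFun (Fin 2) ℝ i)⟫)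
        ≤ ENNReal.ofReal (∫ x, ‖f x‖ ^ 2) := ENNReal.ofReal_le_ofReal h
      _ = ∫⁻ x, ENNReal.ofReal (‖f x‖ ^ 2) :=
          ofReal_integral_eq_lintegral_ofReal hf2 (Eventually.of_forall fun x => sq_nonneg _)
      _ = ∫⁻ x, ‖f x‖ₑ ^ 2 := lintegral_congr fun x => by
          rw [← ofReal_norm, ENNReal.ofReal_pow (norm_nonneg _)]
  · rw [not_lt, top_le_iff] at hf
    rw [hf]
    exact le_top

end TwoDimActionBound

open TwoDimActionBound in
/-- **2-D calibration of the action** (Brzeźniak–Cerrai–Freidlin 2015, Thm. 7.1, the easy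
inequality, on `(EuclideanSpace ℝ (Fin 2))` from rest): for a classical forced path `(w, q, g)` on `(EuclideanSpace ℝ (Fin 2)) × [0, T₀]` with `w`
uniformly Schwartz and `w(0) = 0`, `ν ∫ |∇w(T₀)|²_F ≤ ∫₀^{T₀} ∫ |g|²`.
Proof: the gradient-energy balance `∫|∇w(T₀)|²_F = ∫₀^{T₀} ∫ 2Σᵢ⟪∂ᵢw, ∂ᵢ∂ₜw⟫`
(`gradEnergy_balance`) and, at every time, the planar production bound
`4ν ∫ Σᵢ⟪∂ᵢw, ∂ᵢ∂ₜw⟫ ≤ ∫ |g|²` (`ofReal_production_le₂`: Green, the momentum equation, the 2-D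
cancellation `∫⟪Δw,(w·∇)w⟫ = 0`, the planar pressure identity `∫⟪Δw, ∇q⟫ = 0`, and a completed
square); so even `2ν ∫|∇w(T₀)|²_F ≤ ∫∫|g|²`. HONEST FRAMING: a unit test of the route's definitions
in two dimensions; nothing here bears on three-dimensional Navier–Stokes regularity. [this file] -/
theorem quasipotentialCoercivity_twoDimensionalActionBound_proof :
    Summit.NavierStokesRegularity.NavierStokesRegularity.Theses.QuasipotentialCoercivity.TwoDimensionalActionBound := by
  intro ν hν T₀ hT₀ w q g hcl hdec hw0
  have hU : UniqueDiffOn ℝ (Icc (0 : ℝ) T₀) := uniqueDiffOn_Icc hT₀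
  have hsm : IsSmoothSpaceTimeOn (Icc 0 T₀) w := hcl.smooth_velocity
  have hsmq : IsSmoothSpaceTimeOn (Icc 0 T₀) q := hcl.smooth_pressure
  set W : ℝ → EuclideanSpace ℝ (Fin 2) → EuclideanSpace ℝ (Fin 2) :=
    timeDerivWithin (Icc 0 T₀) w with hWdef
  have hWsm : IsSmoothSpaceTimeOn (Icc 0 T₀) W := hsm.timeDerivWithin hU
  have hWdec : HasUniformRapidDecayOn (Icc 0 T₀) W := hdec.timeDerivWithin hsm hU
  -- uniform Schwartz constants for the slices (weight `(1 + ‖x‖)^{-4}`)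
  obtain ⟨C₀, hC₀0, hC₀⟩ := hdec.exists_uniform_slice_bound hsm hT₀ 0 4
  obtain ⟨C₁, -, hC₁⟩ := hdec.exists_uniform_slice_bound hsm hT₀ 1 4
  obtain ⟨C₂, -, hC₂⟩ := hdec.exists_uniform_slice_bound hsm hT₀ 2 4
  obtain ⟨D₀, -, hD₀⟩ := hWdec.exists_uniform_slice_bound hWsm hT₀ 0 4
  obtain ⟨D₁, -, hD₁⟩ := hWdec.exists_uniform_slice_bound hWsm hT₀ 1 4
  set C : ℝ := max (max (max C₀ C₁) (max C₂ D₀)) D₁ with hCdef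
  have hC0 : 0 ≤ C := hC₀0.trans (le_max_left _ _ |>.trans' (le_max_left _ _ |>.trans' (le_max_left _ _)))
  have hr : (3 : ℝ) < ((4 : ℕ) : ℝ) := by norm_num
  have conv : ∀ {a K : ℝ} (x : EuclideanSpace ℝ (Fin 2)), (1 + ‖x‖) ^ (4 : ℕ) * a ≤ K → K ≤ C →
      a ≤ C * (1 + ‖x‖) ^ (-((4 : ℕ) : ℝ)) := by
    intro a K x h hK
    have h' := le_mul_rpow_neg_of_pow_mul_le h
    exact h'.trans (mul_le_mul_of_nonneg_right hK (Real.rpow_nonneg (by positivity) _))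
  -- the production bound at every time of the slab
  have hslice : ∀ t ∈ Icc (0 : ℝ) T₀, ENNReal.ofReal (4 * ν * ∫ x, ∑ i,
      ⟪fderiv ℝ (w t) x (EuclideanSpace.basisFun (Fin 2) ℝ i), fderiv ℝ (W t) x (EuclideanSpace.basisFun (Fin 2) ℝ i)⟫) ≤ eEnergy (g t) := by
    intro t ht
    have hv : ContDiff ℝ 2 (w t) := (hsm.contDiff_slice ht).of_le (by norm_cast)
    have hV : ContDiff ℝ 1 (W t) := (hWsm.contDiff_slice ht).of_le (by norm_cast)
    have hP : ContDiff ℝ 2 (q t) := (hsmq.contDiff_slice ht).of_le (by norm_cast)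
    have h0 : ∀ x, ‖w t x‖ ≤ C * (1 + ‖x‖) ^ (-((4 : ℕ) : ℝ)) := fun x =>
      conv x (by simpa [norm_iteratedFDeriv_zero] using hC₀ t ht x) (by simp [hCdef])
    have h1 : ∀ x, ‖fderiv ℝ (w t) x‖ ≤ C * (1 + ‖x‖) ^ (-((4 : ℕ) : ℝ)) := fun x =>
      conv x (by simpa [norm_iteratedFDeriv_one] using hC₁ t ht x) (by simp [hCdef])
    have h2 : ∀ x, ‖fderiv ℝ (fderiv ℝ (w t)) x‖ ≤ C * (1 + ‖x‖) ^ (-((4 : ℕ) : ℝ)) := fun x => by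
      refine conv x ?_ (show C₂ ≤ C by simp [hCdef])
      have := hC₂ t ht x
      rwa [← norm_iteratedFDeriv_fderiv, norm_iteratedFDeriv_one] at this
    have hV0 : ∀ x, ‖W t x‖ ≤ C * (1 + ‖x‖) ^ (-((4 : ℕ) : ℝ)) := fun x =>
      conv x (by simpa [norm_iteratedFDeriv_zero] using hD₀ t ht x) (by simp [hCdef])
    have hV1 : ∀ x, ‖fderiv ℝ (W t) x‖ ≤ C * (1 + ‖x‖) ^ (-((4 : ℕ) : ℝ)) := fun x =>
      conv x (by simpa [norm_iteratedFDeriv_one] using hD₁ t ht x) (by simp [hCdef])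
    exact ofReal_production_le₂ hν hv hV hP (hcl.divFree t ht) (hcl.momentum t ht) hC0 hr
      h0 h1 h2 hV0 hV1
  -- the balance from rest
  obtain ⟨-, hbal⟩ := gradEnergy_balance hT₀ hsm hdec
  have hG0 : ∫ x, frobeniusNormSq (fderiv ℝ (w 0) x) = 0 := by
    simp [hw0]
  set φ : ℝ → ℝ := fun t => ∫ x, 2 * ∑ i,
    ⟪fderiv ℝ (w t) x (EuclideanSpace.basisFun (Fin 2) ℝ i), fderiv ℝ (W t) x (EuclideanSpace.basisFun (Fin 2) ℝ i)⟫ with hφ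
  have hGT : ∫ x, frobeniusNormSq (fderiv ℝ (w T₀) x) = ∫ t in Ioo 0 T₀, φ t := by
    rw [hbal T₀ ⟨hT₀, le_rfl⟩, hG0, zero_add, intervalIntegral.integral_of_le hT₀.le,
      integral_Ioc_eq_integral_Ioo]
  -- integrability of `|∇w(T₀)|²_F`
  have hfrobT : Integrable (fun x => frobeniusNormSq (fderiv ℝ (w T₀) x)) volume := by
    have hT : T₀ ∈ Icc (0 : ℝ) T₀ := ⟨hT₀.le, le_rfl⟩
    have hcd : ContDiff ℝ 1 (w T₀) := (hsm.contDiff_slice hT).of_le (by norm_cast)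
    have h1 : ∀ x, ‖fderiv ℝ (w T₀) x‖ ≤ C * (1 + ‖x‖) ^ (-((4 : ℕ) : ℝ)) := fun x =>
      conv x (by simpa [norm_iteratedFDeriv_one] using hC₁ T₀ hT x) (by simp [hCdef])
    refine integrable_of_le_decay₂ (C := 2 * (C * C)) (r := ((4 : ℕ) : ℝ))
      (continuous_frobeniusNormSq_fderiv hcd (by simp)) (by norm_num) fun x => ?_
    rw [Real.norm_eq_abs, abs_of_nonneg (frobeniusNormSq_nonneg _)]
    have hF : frobeniusNormSq (fderiv ℝ (w T₀) x) ≤ 2 * ‖fderiv ℝ (w T₀) x‖ ^ 2 := by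
      rw [frobeniusNormSq_eq_sum (EuclideanSpace.basisFun (Fin 2) ℝ)]
      simpa using sum_sq_norm_apply_le_card_mul_sq_opNorm (EuclideanSpace.basisFun (Fin 2) ℝ) (fderiv ℝ (w T₀) x)
    have hsq : ‖fderiv ℝ (w T₀) x‖ ^ 2 ≤ C * C * (1 + ‖x‖) ^ (-((4 : ℕ) : ℝ)) := by
      rw [sq]
      exact mul_le_decay₂ (by norm_num) x (norm_nonneg _) (norm_nonneg _) (h1 x) (h1 x) hC0
    linarith
  have hGnn : 0 ≤ ∫ x, frobeniusNormSq (fderiv ℝ (w T₀) x) :=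
    integral_nonneg fun x => frobeniusNormSq_nonneg _
  -- conclude in `[0, ∞]`
  calc ENNReal.ofReal ν * ∫⁻ y, ENNReal.ofReal (frobeniusNormSq (fderiv ℝ (w T₀) y))
      = ENNReal.ofReal (ν * ∫ x, frobeniusNormSq (fderiv ℝ (w T₀) x)) := by
        rw [← ofReal_integral_eq_lintegral_ofReal hfrobT
          (Eventually.of_forall fun x => frobeniusNormSq_nonneg _), ENNReal.ofReal_mul hν.le]
    _ ≤ ENNReal.ofReal (2 * ν * ∫ x, frobeniusNormSq (fderiv ℝ (w T₀) x)) := by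
        refine ENNReal.ofReal_le_ofReal ?_
        nlinarith
    _ = ENNReal.ofReal (∫ t in Ioo 0 T₀, 2 * ν * φ t) := by
        rw [hGT, integral_const_mul]
    _ ≤ ∫⁻ t in Ioo 0 T₀, ENNReal.ofReal (2 * ν * φ t) :=
        Literature.MathematicalPhysics.KineticTheory.ofReal_integral_le_lintegral _
    _ ≤ ∫⁻ t in Ioo 0 T₀, eEnergy (g t) := by
        refine setLIntegral_mono' measurableSet_Ioo fun t ht => ?_
        have h := hslice t (Ioo_subset_Icc_self ht)
        have hφt : 2 * ν * φ t = 4 * ν * ∫ x, ∑ i,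
            ⟪fderiv ℝ (w t) x (EuclideanSpace.basisFun (Fin 2) ℝ i), fderiv ℝ (W t) x (EuclideanSpace.basisFun (Fin 2) ℝ i)⟫ := by
          rw [hφ]
          simp only
          rw [integral_const_mul]
          ring
        rwa [hφt]
    _ ≤ ∫⁻ t in Icc 0 T₀, eEnergy (g t) := lintegral_mono_set Ioo_subset_Icc_self

end Summit.NavierStokesRegularity.NavierStokesRegularity.Theorems
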